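import Mathlib
import HarnessLib
import Summits.ValiantsHypothesis.ValiantsHypothesis.Theorems.LacunarySymmetroidMatrixDescartesProductPlusOneTameSector

/-!
# ValiantsHypothesis / LacunarySymmetroid — crux `MatrixDescartes` (stmt-ValiantsHypothesis-18050, V1),
# LINE (A) «product_plus_one», research stub `stub_classRowK3`: the SHARP SECTOR of the `K = 3` row — CALCULUS

A trinomial factor `g = a + b X^p + c X^{p+q′}` (`p = e+1`, `q′ = k+1`) with extreme coefficients of the SAME sign (`a, c > 0`) that
takes a NEGATIVE value somewhere on `(0,∞)` (a «sharp dip»: two positive zeros) has a strictly DECREASING logarithmic derivative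
`φ = x g′/g` in the logarithmic chart on every zero-free interval, for EVERY support (no ratio condition):
`φ′ = W/(x g²)` with `W/x^e = a b p² + a c (p+q′)² x^{q′} + b c q′² x^{p+q′} < 0` (`logWronskian_neg`).  The certificate is the pair of
Young/Bernoulli inequalities `q′ A^{p+q′} + p B^{p+q′} ≥ (p+q′) A^{q′} B^{p}` (`young_nat`) at the critical scale `x*` with
`c q′ x*^{p+q′} = a p` (`exists_critical_scale`, intermediate value theorem): the witness gives `p|b| > (p+q′) c x*^{q′}`
(`beta_bound`) and every `x` gives `x*^{q′}(a p² + c q′² x^{p+q′}) ≥ a p (p+q′) x^{q′}` (`gamma_bound`).  Companion of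
`…ProductPlusOneTameCalculus` (the «no-dip» factors, power chart, ratio ≤ 4); the count is drawn in `…ProductPlusOneSharpSector`.
This is val-v1x-eng-10's «Lemma 2» (sharp factors have monotone φ) for `K = 3`, with an explicit certificate instead of the level count.

HONEST FRAMING: a per-factor lemma for a sector of the research stub; NOT `stub_classRowK3`, not `stub_polyLaw`, not
`ProductPlusOneMDR`, not `MatrixDescartes`, not Conjecture B; `VP ≠ VNP` is NOT proved.  No definitions, no named facts.
-/

-- `Summit.ValiantsHypothesis.ValiantsHypothesis.…` is the tree's mandated single-conjunct layout (Sub = Summit).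
set_option linter.dupNamespace false

namespace Summit.ValiantsHypothesis.ValiantsHypothesis.Theorems.LacunarySymmetroidMatrixDescartes

namespace ProductPlusOne

open Polynomial Finset
open scoped BigOperators

/-! ### Bernoulli / Young with natural exponents -/

/-- Bernoulli: `1 + n (t − 1) ≤ t^n` for `t ≥ 0`. [folklore] -/
theorem bernoulli_pow (t : ℝ) (ht : 0 ≤ t) (n : ℕ) : 1 + n * (t - 1) ≤ t ^ n := by
  have h := one_add_mul_le_pow (a := t - 1) (by linarith) n
  simpa using h

/-- Bernoulli from below for the inverse: `1 − n (t − 1) ≤ t⁻¹ ^ n` for `t > 0`. [folklore] -/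
theorem bernoulli_inv_pow (t : ℝ) (ht : 0 < t) (n : ℕ) : 1 - n * (t - 1) ≤ t⁻¹ ^ n := by
  have h := bernoulli_pow t⁻¹ (inv_pos.mpr ht).le n
  have h2 : -(t - 1) ≤ t⁻¹ - 1 := by
    have : t⁻¹ + t ≥ 2 := by
      have hsq : 0 ≤ (t - 1) ^ 2 / t := div_nonneg (sq_nonneg _) ht.le
      have e : (t - 1) ^ 2 / t = t⁻¹ + t - 2 := by field_simp; ring
      linarith
    linarith
  have h3 : (n : ℝ) * (-(t - 1)) ≤ n * (t⁻¹ - 1) := mul_le_mul_of_nonneg_left h2 (Nat.cast_nonneg n)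
  linarith

/-- **Young with natural exponents**: `q A^{p+q} + p B^{p+q} ≥ (p+q) A^{q} B^{p}` for `A > 0`, `B ≥ 0`. [folklore] -/
theorem young_nat (p q : ℕ) (A B : ℝ) (hA : 0 < A) (hB : 0 ≤ B) :
    ((p : ℝ) + q) * A ^ q * B ^ p ≤ q * A ^ (p + q) + p * B ^ (p + q) := by
  -- τ = B / A ; divide by A^(p+q)
  have hApq : 0 < A ^ (p + q) := pow_pos hA _
  set τ := B / A with hτ
  have hτ0 : 0 ≤ τ := div_nonneg hB hA.le
  have hBA : B = τ * A := by rw [hτ, div_mul_cancel₀ B hA.ne']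
  -- reduce to: (p+q) τ^p ≤ q + p τ^(p+q)
  have key : ((p : ℝ) + q) * τ ^ p ≤ q + p * τ ^ (p + q) := by
    -- τ^p (1 − p(τ−1)) ≤ 1
    have h1 : τ ^ p * (1 - p * (τ - 1)) ≤ 1 := by
      rcases le_or_gt (1 - (p : ℝ) * (τ - 1)) 0 with hle | hgt
      · exact (mul_nonpos_of_nonneg_of_nonpos (pow_nonneg hτ0 _) hle).trans zero_le_one
      · rcases eq_or_lt_of_le hτ0 with h0 | hτpos
        · -- τ = 0
          have hτz : τ = 0 := h0.symm
          rw [hτz]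
          cases p with
          | zero => norm_num
          | succ n => rw [zero_pow (Nat.succ_ne_zero n), zero_mul]; norm_num
        · have hb := bernoulli_inv_pow τ hτpos p
          calc τ ^ p * (1 - p * (τ - 1)) ≤ τ ^ p * τ⁻¹ ^ p :=
                mul_le_mul_of_nonneg_left hb (pow_nonneg hτ0 _)
            _ = 1 := by rw [← mul_pow, mul_inv_cancel₀ hτpos.ne', one_pow]
    -- p τ^p τ^q ≥ p τ^p (1 + q(τ−1))
    have h2 : (p : ℝ) * τ ^ p * (1 + q * (τ - 1)) ≤ p * τ ^ (p + q) := by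
      rw [pow_add, ← mul_assoc]
      exact mul_le_mul_of_nonneg_left (bernoulli_pow τ hτ0 q) (mul_nonneg (Nat.cast_nonneg p) (pow_nonneg hτ0 _))
    nlinarith [h1, h2, pow_nonneg hτ0 p, (Nat.cast_nonneg p : (0 : ℝ) ≤ p), (Nat.cast_nonneg q : (0 : ℝ) ≤ q)]
  -- scale back
  have e1 : A ^ q * B ^ p = A ^ (p + q) * τ ^ p := by
    rw [hBA, mul_pow, pow_add]; ring
  have e2 : B ^ (p + q) = A ^ (p + q) * τ ^ (p + q) := by
    rw [hBA, mul_pow]; ring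
  rw [mul_assoc, e1, e2]
  have := mul_le_mul_of_nonneg_left key hApq.le
  nlinarith [this]

/-! ### The critical scale -/

/-- The critical scale `x*` of a dip: `c q′ x*^{p+q′} = a p` (`a, c > 0`, `p = e+1`, `q′ = k+1`). [folklore] -/
theorem exists_critical_scale (a c : ℝ) (ha : 0 < a) (hc : 0 < c) (e k : ℕ) :
    ∃ xs : ℝ, 0 < xs ∧ c * ((k : ℝ) + 1) * xs ^ (e + k + 2) = a * ((e : ℝ) + 1) := by
  -- IVT for x ↦ c (k+1) x^(e+k+2) on [0, M]
  set M : ℝ := a * (e + 1) / (c * (k + 1)) + 1 with hM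
  have hck : 0 < c * ((k : ℝ) + 1) := by positivity
  have hM1 : 1 ≤ M := by
    have : 0 ≤ a * (e + 1) / (c * (k + 1)) := by positivity
    linarith
  have hM0 : 0 < M := by linarith
  have hcont : ContinuousOn (fun x : ℝ => c * ((k : ℝ) + 1) * x ^ (e + k + 2)) (Set.Icc 0 M) :=
    (continuous_const.mul (continuous_pow _)).continuousOn
  have hlo : (fun x : ℝ => c * ((k : ℝ) + 1) * x ^ (e + k + 2)) 0 ≤ a * ((e : ℝ) + 1) := by
    simp only [zero_pow (by omega : e + k + 2 ≠ 0), mul_zero]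
    positivity
  have hhi : a * ((e : ℝ) + 1) ≤ (fun x : ℝ => c * ((k : ℝ) + 1) * x ^ (e + k + 2)) M := by
    simp only
    have hMp : M ≤ M ^ (e + k + 2) := le_self_pow₀ hM1 (by omega)
    have h1 : a * ((e : ℝ) + 1) ≤ c * ((k : ℝ) + 1) * M := by
      have hcm : c * ((k : ℝ) + 1) * M = a * ((e : ℝ) + 1) + c * ((k : ℝ) + 1) := by
        rw [hM]
        field_simp
      rw [hcm]
      linarith
    exact h1.trans (mul_le_mul_of_nonneg_left hMp hck.le)
  obtain ⟨xs, hxs, hval⟩ := intermediate_value_Icc hM0.le hcont ⟨hlo, hhi⟩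
  have hxs0 : 0 < xs := by
    rcases eq_or_lt_of_le hxs.1 with h0 | h0
    · rw [← h0] at hval
      simp only [zero_pow (by omega : e + k + 2 ≠ 0), mul_zero] at hval
      have : 0 < a * ((e : ℝ) + 1) := by positivity
      linarith
    · exact h0
  exact ⟨xs, hxs0, hval⟩

/-! ### The two bounds at the critical scale -/

/-- **β-bound**: a dip value `a + b x₀^p + c x₀^{p+q′} < 0` at some `x₀ > 0` forces `p·(−b) > (p+q′)·c·x*^{q′}`. [this file's lemma] -/
theorem beta_bound (a b c x₀ xs : ℝ) (e k : ℕ) (hc : 0 < c) (hx₀ : 0 < x₀) (hxs : 0 < xs)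
    (hcrit : c * ((k : ℝ) + 1) * xs ^ (e + k + 2) = a * ((e : ℝ) + 1))
    (hneg : a + b * x₀ ^ (e + 1) + c * x₀ ^ (e + k + 2) < 0) :
    ((e : ℝ) + k + 2) * c * xs ^ (k + 1) < ((e : ℝ) + 1) * (-b) := by
  -- Young: (k+1) xs^{p+q'} + (e+1) x₀^{p+q'} ≥ (p+q') xs^{q'} x₀^{p}
  have hy := young_nat (e + 1) (k + 1) xs x₀ hxs hx₀.le
  have hp : 0 < x₀ ^ (e + 1) := pow_pos hx₀ _
  -- (e+1)(−b) x₀^p > (e+1)(a + c x₀^{p+q'}) = c[(k+1) xs^{p+q'} + (e+1) x₀^{p+q'}] ≥ c (p+q') xs^{q'} x₀^p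
  have h1 : ((e : ℝ) + 1) * (a + c * x₀ ^ (e + k + 2)) < ((e : ℝ) + 1) * (-b) * x₀ ^ (e + 1) := by
    have : ((e : ℝ) + 1) * (a + b * x₀ ^ (e + 1) + c * x₀ ^ (e + k + 2)) < 0 :=
      mul_neg_of_pos_of_neg (by positivity) hneg
    nlinarith
  have h2 : ((e : ℝ) + 1) * (a + c * x₀ ^ (e + k + 2))
      = c * (((k : ℝ) + 1) * xs ^ (e + 1 + (k + 1)) + ((e : ℝ) + 1) * x₀ ^ (e + 1 + (k + 1))) := by
    rw [show e + 1 + (k + 1) = e + k + 2 by ring]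
    nlinarith [hcrit]
  have h3 : c * ((((e + 1 : ℕ) : ℝ) + ((k + 1 : ℕ) : ℝ)) * xs ^ (k + 1) * x₀ ^ (e + 1))
      ≤ c * (((k + 1 : ℕ) : ℝ) * xs ^ (e + 1 + (k + 1)) + ((e + 1 : ℕ) : ℝ) * x₀ ^ (e + 1 + (k + 1))) :=
    mul_le_mul_of_nonneg_left hy hc.le
  push_cast at h3
  have h4 : c * ((((e : ℝ) + 1) + ((k : ℝ) + 1)) * xs ^ (k + 1) * x₀ ^ (e + 1))
      < ((e : ℝ) + 1) * (-b) * x₀ ^ (e + 1) := by linarith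
  have h5 : (((e : ℝ) + k + 2) * c * xs ^ (k + 1)) * x₀ ^ (e + 1) < (((e : ℝ) + 1) * (-b)) * x₀ ^ (e + 1) := by
    have : c * ((((e : ℝ) + 1) + ((k : ℝ) + 1)) * xs ^ (k + 1) * x₀ ^ (e + 1))
        = (((e : ℝ) + k + 2) * c * xs ^ (k + 1)) * x₀ ^ (e + 1) := by ring
    linarith
  exact lt_of_mul_lt_mul_right h5 hp.le

/-- **γ-bound**: for every `x ≥ 0`, `x*^{q′} (a p² + c q′² x^{p+q′}) ≥ a p (p+q′) x^{q′}`. [this file's lemma] -/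
theorem gamma_bound (a c x xs : ℝ) (e k : ℕ) (hc : 0 < c) (hx : 0 ≤ x) (hxs : 0 < xs)
    (hcrit : c * ((k : ℝ) + 1) * xs ^ (e + k + 2) = a * ((e : ℝ) + 1)) :
    a * ((e : ℝ) + 1) * ((e : ℝ) + k + 2) * x ^ (k + 1)
      ≤ xs ^ (k + 1) * (a * ((e : ℝ) + 1) ^ 2 + c * ((k : ℝ) + 1) ^ 2 * x ^ (e + k + 2)) := by
  -- Young with roles swapped: (e+1) xs^{p+q'} + (k+1) x^{p+q'} ≥ (p+q') xs^{p} x^{q'}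
  have hy := young_nat (k + 1) (e + 1) xs x hxs hx
  push_cast at hy
  -- multiply by c (k+1) > 0 and use c (k+1) xs^{p+q'} = a (e+1)
  have epow : e + k + 2 = k + 1 + (e + 1) := by ring
  rw [epow] at hcrit ⊢
  have eL : a * ((e : ℝ) + 1) * ((e : ℝ) + k + 2) * x ^ (k + 1)
      = xs ^ (k + 1) * (c * ((k : ℝ) + 1)) * ((((k : ℝ) + 1) + ((e : ℝ) + 1)) * xs ^ (e + 1) * x ^ (k + 1)) := by
    rw [← hcrit]; ring
  have eR : xs ^ (k + 1) * (a * ((e : ℝ) + 1) ^ 2 + c * ((k : ℝ) + 1) ^ 2 * x ^ (k + 1 + (e + 1)))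
      = xs ^ (k + 1) * (c * ((k : ℝ) + 1))
        * (((e : ℝ) + 1) * xs ^ (k + 1 + (e + 1)) + ((k : ℝ) + 1) * x ^ (k + 1 + (e + 1))) := by
    have h2 : a * ((e : ℝ) + 1) ^ 2 = (a * ((e : ℝ) + 1)) * ((e : ℝ) + 1) := by ring
    rw [h2, ← hcrit]; ring
  rw [eL, eR]
  exact mul_le_mul_of_nonneg_left hy (by positivity)

/-- **The logarithmic Wronskian of a sharp dip is negative**: for `a, c > 0` and a witness `g(x₀) < 0`, for all `x > 0`,
`a b p² + a c (p+q′)² x^{q′} + b c q′² x^{p+q′} < 0` (`p = e+1`, `q′ = k+1`). [this file's theorem] -/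
theorem logWronskian_neg (a b c x₀ : ℝ) (e k : ℕ) (ha : 0 < a) (hc : 0 < c) (hx₀ : 0 < x₀)
    (hneg : a + b * x₀ ^ (e + 1) + c * x₀ ^ (e + k + 2) < 0) {x : ℝ} (hx : 0 < x) :
    a * b * ((e : ℝ) + 1) ^ 2 + a * c * ((e : ℝ) + k + 2) ^ 2 * x ^ (k + 1)
      + b * c * ((k : ℝ) + 1) ^ 2 * x ^ (e + k + 2) < 0 := by
  obtain ⟨xs, hxs, hcrit⟩ := exists_critical_scale a c ha hc e k
  have hβ := beta_bound a b c x₀ xs e k hc hx₀ hxs hcrit hneg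
  have hγ := gamma_bound a c x xs e k hc hx.le hxs hcrit
  have hD : 0 < a * ((e : ℝ) + 1) ^ 2 + c * ((k : ℝ) + 1) ^ 2 * x ^ (e + k + 2) := by positivity
  -- p·(goal expression) = c(p+q')·(a p (p+q') x^{q'}) − p(−b)·D ≤ c(p+q') xs^{q'} D − p(−b) D < 0
  have h3 : c * ((e : ℝ) + k + 2) * (a * ((e : ℝ) + 1) * ((e : ℝ) + k + 2) * x ^ (k + 1))
      ≤ c * ((e : ℝ) + k + 2) * (xs ^ (k + 1) * (a * ((e : ℝ) + 1) ^ 2 + c * ((k : ℝ) + 1) ^ 2 * x ^ (e + k + 2))) :=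
    mul_le_mul_of_nonneg_left hγ (by positivity)
  have h4 : ((e : ℝ) + k + 2) * c * xs ^ (k + 1) * (a * ((e : ℝ) + 1) ^ 2 + c * ((k : ℝ) + 1) ^ 2 * x ^ (e + k + 2))
      < ((e : ℝ) + 1) * (-b) * (a * ((e : ℝ) + 1) ^ 2 + c * ((k : ℝ) + 1) ^ 2 * x ^ (e + k + 2)) :=
    mul_lt_mul_of_pos_right hβ hD
  have e5 : ((e : ℝ) + 1) * (a * b * ((e : ℝ) + 1) ^ 2 + a * c * ((e : ℝ) + k + 2) ^ 2 * x ^ (k + 1)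
      + b * c * ((k : ℝ) + 1) ^ 2 * x ^ (e + k + 2))
      = c * ((e : ℝ) + k + 2) * (a * ((e : ℝ) + 1) * ((e : ℝ) + k + 2) * x ^ (k + 1))
        - ((e : ℝ) + 1) * (-b) * (a * ((e : ℝ) + 1) ^ 2 + c * ((k : ℝ) + 1) ^ 2 * x ^ (e + k + 2)) := by ring
  have e6 : c * ((e : ℝ) + k + 2) * (xs ^ (k + 1) * (a * ((e : ℝ) + 1) ^ 2 + c * ((k : ℝ) + 1) ^ 2 * x ^ (e + k + 2)))
      = ((e : ℝ) + k + 2) * c * xs ^ (k + 1) * (a * ((e : ℝ) + 1) ^ 2 + c * ((k : ℝ) + 1) ^ 2 * x ^ (e + k + 2)) := by ring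
  have h7 : ((e : ℝ) + 1) * (a * b * ((e : ℝ) + 1) ^ 2 + a * c * ((e : ℝ) + k + 2) ^ 2 * x ^ (k + 1)
      + b * c * ((k : ℝ) + 1) ^ 2 * x ^ (e + k + 2)) < 0 := by
    rw [e5]
    rw [e6] at h3
    linarith
  have hp : (0 : ℝ) < (e : ℝ) + 1 := by positivity
  by_contra hcon
  push Not at hcon
  have := mul_nonneg hp.le hcon
  linarith

end ProductPlusOne

end Summit.ValiantsHypothesis.ValiantsHypothesis.Theorems.LacunarySymmetroidMatrixDescartes
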